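import Summits.Ventures.LatticeQCDFlow.Exactness.IMHCoupledEstimatorHoeffding
import Summits.Ventures.LatticeQCDFlow.Exactness.IMHCoupledEstimatorCorrectionTail
import Summits.Ventures.LatticeQCDFlow.Exactness.IMHCommonRandomNumbersPathObservables
import HarnessLib

/-!
# Burn-in buys the equilibrium Hoeffding bar: for `R` independent coupled pairs of the exact sampler,
# `P(|H̄_R − π f| ≥ ε + (1 − A)^k(c − a)) ≤ 2·exp(−2Rε²/(c − a)²) + R·(1 − A)^k·P(X_0 ≠ X′_0)`

HONEST FRAMING: exact (Metropolis-corrected) sampling algorithms for lattice gauge theory;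
figures of merit are autocorrelation/cost numbers at stated couplings and volumes; no
continuum-physics claim.

Venture `LatticeQCDFlow` (cell pub-lqcd), topic `Exactness`; FANOUT row 30 (lean-1, GEN-39).  NEW WORK of the cell, general state
space with `MeasurableEq Ω`; sequel to this generation's `Exactness/IMHCoupledEstimatorHoeffding` (range `(2N + 1)(c − a)` ⇒ exponent
`2Rε²/((2N + 1)(c − a))²`) and `Exactness/IMHCoupledEstimatorCorrectionTail` (`P(Σ_{n<N} D_{k+n} ≠ 0) ≤ r^k·p₀`: after `k` burn-in
updates the coupled estimate IS the plain read-out `f(Y_k)` except with probability `≤ r^k p₀`).  Combining the two: on the event that no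
replica carries a correction, the average of the coupled estimates is the average of `R` independent bounded read-outs `f(Y_k^{(j)}) ∈ [a, c]`
with common mean `(ν₂K^k) f` (within `r^k(c − a)` of `π f`), to which Hoeffding applies WITH THE EQUILIBRIUM RANGE `c − a`; the
complementary event costs `R·r^k·p₀` by a union bound (`p₀ = ν̂(Δᶜ) = P(X_0 ≠ X′_0)`, `W = w(x₀)`, `r = 1 − 1/W`):

* §1 (bookkeeping) **`crnLag_replica_correction_ne_zero_le`** — per replica `P(Σ_{n<N} D_{k+n}(Z_j) ≠ 0) ≤ r^k p₀` (transfer along the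
  law); **`crnLag_replicas_some_correction_le`** — `P(∃ j < R, Σ_{n<N} D_{k+n}(Z_j) ≠ 0) ≤ R·r^k·p₀`;
  **`crnLag_replicas_readout_hoeffding_abs`** — Hoeffding for the read-outs: `P(|R⁻¹Σ_{j<R} f(Y_k^{(j)}) − (ν₂K^k) f| ≥ ε) ≤ 2·exp(−2Rε²/(c − a)²)`.
* §2 **`crnLag_replicas_burnIn_hoeffding_abs`** — `P(|H̄_R − (ν₂K^k) f| ≥ ε) ≤ 2·exp(−2Rε²/(c − a)²) + R·r^k·p₀`;
  **`crnLag_replicas_burnIn_hoeffding_abs_target`** — ABOUT `π f`: `P(|H̄_R − π f| ≥ ε + r^k(c − a)) ≤ 2·exp(−2Rε²/(c − a)²) + R·r^k·p₀`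
  for every `ε ≥ 0`, `R ≥ 1`, `N`: THE SAME EXPONENTIAL BAR AS `R` INDEPENDENT EQUILIBRIUM MEASUREMENTS, up to the additive `R·r^k·p₀`
  and the bias allowance `r^k(c − a)` — both geometrically small in the burn-in `k` (a burn-in of `(log R + log(1/δ))/A` updates makes the
  additive term `≤ δ`).
* §3 **`crnLag_untruncated_replicas_burnIn_hoeffding_abs_target`** — THE SAME FOR THE EXACTLY UNBIASED (UNTRUNCATED) ESTIMATOR `H_k`:
  `P(|R⁻¹Σ_{j<R} H_k(Z_j) − π f| ≥ ε + r^k(c − a)) ≤ 2·exp(−2Rε²/(c − a)²) + R·r^k·p₀` (a replica carries a correction only if its runs still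
  differ at some time `≥ k`, probability `≤ r^k p₀` by GEN-38's `crn_chain_notMerged_after_le`).
* §4 **`crnLag_untruncated_replicas_budget`** — THE RECIPE (numbers): `a < c`, `R ≥ 1` with `(c − a)²·log(4/δ) ≤ 2Rε²`, burn-in `k` with `log((c − a)/ε) ≤ k·A` and
  (`p₀ = 0` or `log(2R·p₀/δ) ≤ k·A`) ⇒ `P(|R⁻¹Σ_{j<R} H_k(Z_j) − π f| ≥ 2ε) ≤ δ`: `R = ⌈(c − a)² log(4/δ)/(2ε²)⌉` pairs and
  `k = ⌈W·max(log((c − a)/ε), log(2R p₀/δ))⌉` burn-in updates certify accuracy `2ε` at confidence `1 − δ` for `π f` ITSELF (`one_sub_inv_pow_le_of_log_le`,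
  `two_mul_exp_le_of_log_le` [bookkeeping]).
Reading (gauge files): for `R` independent coupled pairs of two exact gauge samplers on one stream of random numbers, after `k` discarded
updates the averaged burn-in-free estimate obeys the equilibrium Hoeffding bar up to `R(1 − A)^k`.
NOT CLAIMED: a variance-sensitive (Bernstein) exponent; anything for unbounded `f` or any value of `A`.  No `sorry`, no new
definitions, nothing cited as a fact.
-/

noncomputable section

namespace Summit.Ventures.LatticeQCDFlow.Exactness

open MeasureTheory ProbabilityTheory Function Finset Filter
open scoped ENNReal unitInterval Topology NNReal
open Summit.Ventures.LatticeQCDFlow.Scoring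

variable {Ω : Type*} [MeasurableSpace Ω] {q : Measure Ω} [IsProbabilityMeasure q] {w : Ω → ℝ}

/-! ## §4 A sample-size recipe (real-analysis bookkeeping, then the recipe) -/

omit [MeasurableSpace Ω] [IsProbabilityMeasure q] in
/-- `log(1/y) ≤ k·(1/W) ⇒ (1 − 1/W)^k ≤ y` for `W ≥ 1`, `y > 0`. [ours, bookkeeping] -/
theorem one_sub_inv_pow_le_of_log_le {W y : ℝ} (hW : 1 ≤ W) (hy : 0 < y) {k : ℕ} (hk : Real.log (1 / y) ≤ k * W⁻¹) :
    (1 - W⁻¹) ^ k ≤ y := by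
  have hr0 : 0 ≤ 1 - W⁻¹ := sub_nonneg.2 (inv_le_one_of_one_le₀ hW)
  calc (1 - W⁻¹) ^ k ≤ Real.exp (-W⁻¹) ^ k := by
        gcongr
        have := Real.add_one_le_exp (-W⁻¹)
        linarith
    _ = Real.exp (-(k * W⁻¹)) := by rw [← Real.exp_nat_mul]; ring_nf
    _ ≤ Real.exp (-Real.log (1 / y)) := Real.exp_le_exp.2 (neg_le_neg hk)
    _ = y := by rw [Real.exp_neg, Real.exp_log (by positivity), one_div, inv_inv]

omit [MeasurableSpace Ω] [IsProbabilityMeasure q] in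
/-- `(c − a)²·log(4/δ) ≤ 2Rε²` with `a < c` ⇒ `2·exp(−2Rε²/(c − a)²) ≤ δ/2`. [ours, bookkeeping] -/
theorem two_mul_exp_le_of_log_le {a c ε δ : ℝ} (hac : a < c) (hδ : 0 < δ) {R : ℕ}
    (hR : (c - a) ^ 2 * Real.log (4 / δ) ≤ 2 * R * ε ^ 2) :
    2 * Real.exp (-(2 * R * ε ^ 2) / (c - a) ^ 2) ≤ δ / 2 := by
  have hca : 0 < (c - a) ^ 2 := by positivity
  have h1 : Real.log (4 / δ) ≤ 2 * R * ε ^ 2 / (c - a) ^ 2 := by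
    rw [le_div_iff₀ hca]; linarith
  have h2 : Real.exp (-(2 * R * ε ^ 2) / (c - a) ^ 2) ≤ δ / 4 := by
    calc Real.exp (-(2 * R * ε ^ 2) / (c - a) ^ 2) ≤ Real.exp (-Real.log (4 / δ)) := by
          rw [neg_div]; exact Real.exp_le_exp.2 (neg_le_neg h1)
      _ = δ / 4 := by rw [Real.exp_neg, Real.exp_log (by positivity), inv_div]
  linarith

section Replicas

variable {Ω' : Type*} {mΩ' : MeasurableSpace Ω'} {μ : Measure Ω'} [IsProbabilityMeasure μ]
  {Z : ℕ → Ω' → (ℕ → Ω × Ω)}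

/-! ## §1 Bookkeeping: rare corrections across replicas, Hoeffding for the read-outs -/

omit [IsProbabilityMeasure μ] in
/-- **PER REPLICA `P(Σ_{n<N} D_{k+n}(Z_j) ≠ 0) ≤ r^k·p₀`** (`w` normalised, maximal at `x₀`; `MeasurableEq Ω`; transfer of
`crnLag_correction_ne_zero_le` along the law of the stream). [ours, bookkeeping] -/
theorem crnLag_replica_correction_ne_zero_le [MeasurableEq Ω] [Fact (Measurable w)] (hw0 : ∀ y, 0 < w y) {x₀ : Ω}
    (hmax : ∀ y, w y ≤ w x₀) [IsProbabilityMeasure (q.withDensity fun y => ENNReal.ofReal (w y))]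
    (Khat : Kernel (Ω × Ω) (Ω × Ω)) [IsMarkovKernel Khat]
    (hK : ∀ z : Ω × Ω, Khat z = (q.prod (volume : Measure unitInterval)).map (fun p : Ω × unitInterval =>
      ((if (p.2 : ℝ) * w z.1 ≤ w p.1 then p.1 else z.1), (if (p.2 : ℝ) * w z.2 ≤ w p.1 then p.1 else z.2))))
    (ν : Measure (Ω × Ω)) [IsProbabilityMeasure ν] {f : Ω → ℝ} (hf : Measurable f) {a c : ℝ} (ha : ∀ x, a ≤ f x)
    (hc : ∀ x, f x ≤ c) (k N : ℕ) (hZm : ∀ j, Measurable (Z j)) {j : ℕ}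
    (hlaw : μ.map (Z j) = Kernel.trajMeasure (X := fun _ : ℕ => Ω × Ω) ν
      (fun n : ℕ => Khat.comap (fun h : (i : ↥(Finset.Iic n)) → Ω × Ω => h ⟨n, Finset.mem_Iic.2 le_rfl⟩)
        (measurable_pi_apply _))) :
    μ.real {ω | ∑ n ∈ range N, (f ((Z j ω (k + n)).1) - f ((Z j ω (k + n)).2)) ≠ 0} ≤
      (1 - (w x₀)⁻¹) ^ k * ν.real (Set.diagonal Ω)ᶜ := by
  have hw : Measurable w := Fact.out
  have hSm : Measurable fun z : ℕ → Ω × Ω => ∑ n ∈ range N, (f ((z (k + n)).1) - f ((z (k + n)).2)) :=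
    Finset.measurable_sum _ fun n _ =>
      (hf.comp (measurable_fst.comp (measurable_pi_apply (k + n)))).sub (hf.comp (measurable_snd.comp (measurable_pi_apply (k + n))))
  have hE : MeasurableSet {z : ℕ → Ω × Ω | ∑ n ∈ range N, (f ((z (k + n)).1) - f ((z (k + n)).2)) ≠ 0} :=
    hSm (measurableSet_singleton 0).compl
  have heq : μ.real {ω | ∑ n ∈ range N, (f ((Z j ω (k + n)).1) - f ((Z j ω (k + n)).2)) ≠ 0} =
      (μ.map (Z j)).real {z : ℕ → Ω × Ω | ∑ n ∈ range N, (f ((z (k + n)).1) - f ((z (k + n)).2)) ≠ 0} := by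
    rw [measureReal_def, measureReal_def, Measure.map_apply (hZm j) hE]; rfl
  rw [heq, hlaw]
  exact crnLag_correction_ne_zero_le hw hw0 hmax Khat hK ν ha hc k N

omit [IsProbabilityMeasure μ] in
/-- **`P(∃ j < R, Σ_{n<N} D_{k+n}(Z_j) ≠ 0) ≤ R·r^k·p₀`** (union bound). [ours, bookkeeping] -/
theorem crnLag_replicas_some_correction_le [MeasurableEq Ω] [Fact (Measurable w)] (hw0 : ∀ y, 0 < w y) {x₀ : Ω}
    (hmax : ∀ y, w y ≤ w x₀) [IsProbabilityMeasure (q.withDensity fun y => ENNReal.ofReal (w y))]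
    (Khat : Kernel (Ω × Ω) (Ω × Ω)) [IsMarkovKernel Khat]
    (hK : ∀ z : Ω × Ω, Khat z = (q.prod (volume : Measure unitInterval)).map (fun p : Ω × unitInterval =>
      ((if (p.2 : ℝ) * w z.1 ≤ w p.1 then p.1 else z.1), (if (p.2 : ℝ) * w z.2 ≤ w p.1 then p.1 else z.2))))
    (ν : Measure (Ω × Ω)) [IsProbabilityMeasure ν] {f : Ω → ℝ} (hf : Measurable f) {a c : ℝ} (ha : ∀ x, a ≤ f x)
    (hc : ∀ x, f x ≤ c) (k N : ℕ) (hZm : ∀ j, Measurable (Z j))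
    (hlaw : ∀ j, μ.map (Z j) = Kernel.trajMeasure (X := fun _ : ℕ => Ω × Ω) ν
      (fun n : ℕ => Khat.comap (fun h : (i : ↥(Finset.Iic n)) → Ω × Ω => h ⟨n, Finset.mem_Iic.2 le_rfl⟩)
        (measurable_pi_apply _))) (R : ℕ) :
    μ.real (⋃ j ∈ range R, {ω | ∑ n ∈ range N, (f ((Z j ω (k + n)).1) - f ((Z j ω (k + n)).2)) ≠ 0}) ≤
      R * ((1 - (w x₀)⁻¹) ^ k * ν.real (Set.diagonal Ω)ᶜ) := by
  calc μ.real (⋃ j ∈ range R, {ω | ∑ n ∈ range N, (f ((Z j ω (k + n)).1) - f ((Z j ω (k + n)).2)) ≠ 0})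
      ≤ ∑ j ∈ range R, μ.real {ω | ∑ n ∈ range N, (f ((Z j ω (k + n)).1) - f ((Z j ω (k + n)).2)) ≠ 0} :=
        measureReal_biUnion_finset_le _ _
    _ ≤ ∑ j ∈ range R, (1 - (w x₀)⁻¹) ^ k * ν.real (Set.diagonal Ω)ᶜ :=
        sum_le_sum fun j _ => crnLag_replica_correction_ne_zero_le hw0 hmax Khat hK ν hf ha hc k N hZm (hlaw j)
    _ = R * ((1 - (w x₀)⁻¹) ^ k * ν.real (Set.diagonal Ω)ᶜ) := by rw [sum_const, card_range, nsmul_eq_mul]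

/-- **HOEFFDING FOR THE PLAIN READ-OUTS `f(Y_k^{(j)}) ∈ [a, c]`** across mutually independent pair streams with the common law of the
pair chain: `P(|R⁻¹Σ_{j<R} f(Y_k^{(j)}) − (ν₂K^k) f| ≥ ε) ≤ 2·exp(−2Rε²/(c − a)²)` for `ε ≥ 0`, `R ≥ 1`. [ours] -/
theorem crnLag_replicas_readout_hoeffding_abs [Fact (Measurable w)] (hw0 : ∀ y, 0 < w y)
    (Khat : Kernel (Ω × Ω) (Ω × Ω)) [IsMarkovKernel Khat]
    (hK : ∀ z : Ω × Ω, Khat z = (q.prod (volume : Measure unitInterval)).map (fun p : Ω × unitInterval =>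
      ((if (p.2 : ℝ) * w z.1 ≤ w p.1 then p.1 else z.1), (if (p.2 : ℝ) * w z.2 ≤ w p.1 then p.1 else z.2))))
    (ν : Measure (Ω × Ω)) [IsProbabilityMeasure ν] {f : Ω → ℝ} (hf : Measurable f) {a c : ℝ} (ha : ∀ x, a ≤ f x)
    (hc : ∀ x, f x ≤ c) (k : ℕ) (hZm : ∀ j, Measurable (Z j))
    (hlaw : ∀ j, μ.map (Z j) = Kernel.trajMeasure (X := fun _ : ℕ => Ω × Ω) ν
      (fun n : ℕ => Khat.comap (fun h : (i : ↥(Finset.Iic n)) → Ω × Ω => h ⟨n, Finset.mem_Iic.2 le_rfl⟩)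
        (measurable_pi_apply _)))
    (hind : iIndepFun Z μ) {ε : ℝ} (hε : 0 ≤ ε) {R : ℕ} (hR : 1 ≤ R) :
    μ.real {ω | ε ≤ |(R : ℝ)⁻¹ * ∑ j ∈ range R, f ((Z j ω k).2) -
        ∫ y, f y ∂((fun m : Measure Ω => m.bind (indepMH q w))^[k] (ν.map Prod.snd))|} ≤
      2 * Real.exp (-(2 * R * ε ^ 2) / (c - a) ^ 2) := by
  have hFm : Measurable fun z : ℕ → Ω × Ω => f ((z k).2) := hf.comp (measurable_snd.comp (measurable_pi_apply k))
  have hC : ∀ x, |f x| ≤ max |a| |c| := fun x => abs_le_max_abs_abs (ha x) (hc x)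
  have hmean : ∀ j, μ[fun ω => f ((Z j ω k).2)] = ∫ y, f y ∂((fun m : Measure Ω => m.bind (indepMH q w))^[k] (ν.map Prod.snd)) :=
    fun j => by
    rw [integral_comp_eq_of_map_eq (hZm j) (hlaw j) hFm]
    exact crnLag_integral_snd_eq hw0 Khat hK ν hf hC k
  exact hoeffding_avg_abs_of_mem_Icc (μ := μ) (X := fun j ω => f ((Z j ω k).2)) (fun j => hFm.comp (hZm j))
    (hind.comp (fun _ => _) fun _ => hFm) (fun j ω => ⟨ha _, hc _⟩) hmean hε hR

/-! ## §2 The burn-in Hoeffding bar -/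

/-- **`P(|H̄_R − (ν₂K^k) f| ≥ ε) ≤ 2·exp(−2Rε²/(c − a)²) + R·r^k·p₀`** for `ε ≥ 0`, `R ≥ 1`, every window `N`: on the event that no
replica carries a correction the coupled average IS the read-out average. [ours] -/
theorem crnLag_replicas_burnIn_hoeffding_abs [MeasurableEq Ω] [Fact (Measurable w)] (hw0 : ∀ y, 0 < w y) {x₀ : Ω}
    (hmax : ∀ y, w y ≤ w x₀) [IsProbabilityMeasure (q.withDensity fun y => ENNReal.ofReal (w y))]
    (Khat : Kernel (Ω × Ω) (Ω × Ω)) [IsMarkovKernel Khat]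
    (hK : ∀ z : Ω × Ω, Khat z = (q.prod (volume : Measure unitInterval)).map (fun p : Ω × unitInterval =>
      ((if (p.2 : ℝ) * w z.1 ≤ w p.1 then p.1 else z.1), (if (p.2 : ℝ) * w z.2 ≤ w p.1 then p.1 else z.2))))
    (ν : Measure (Ω × Ω)) [IsProbabilityMeasure ν] {f : Ω → ℝ} (hf : Measurable f) {a c : ℝ} (ha : ∀ x, a ≤ f x)
    (hc : ∀ x, f x ≤ c) (k N : ℕ) (hZm : ∀ j, Measurable (Z j))
    (hlaw : ∀ j, μ.map (Z j) = Kernel.trajMeasure (X := fun _ : ℕ => Ω × Ω) ν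
      (fun n : ℕ => Khat.comap (fun h : (i : ↥(Finset.Iic n)) → Ω × Ω => h ⟨n, Finset.mem_Iic.2 le_rfl⟩)
        (measurable_pi_apply _)))
    (hind : iIndepFun Z μ) {ε : ℝ} (hε : 0 ≤ ε) {R : ℕ} (hR : 1 ≤ R) :
    μ.real {ω | ε ≤ |(R : ℝ)⁻¹ * ∑ j ∈ range R, (f ((Z j ω k).2) + ∑ n ∈ range N, (f ((Z j ω (k + n)).1) - f ((Z j ω (k + n)).2))) -
        ∫ y, f y ∂((fun m : Measure Ω => m.bind (indepMH q w))^[k] (ν.map Prod.snd))|} ≤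
      2 * Real.exp (-(2 * R * ε ^ 2) / (c - a) ^ 2) + R * ((1 - (w x₀)⁻¹) ^ k * ν.real (Set.diagonal Ω)ᶜ) := by
  set mk := ∫ y, f y ∂((fun m : Measure Ω => m.bind (indepMH q w))^[k] (ν.map Prod.snd)) with hmk
  set B : Set Ω' := ⋃ j ∈ range R, {ω | ∑ n ∈ range N, (f ((Z j ω (k + n)).1) - f ((Z j ω (k + n)).2)) ≠ 0} with hB
  -- off `B` the coupled average is the read-out average
  have hsub : {ω | ε ≤ |(R : ℝ)⁻¹ * ∑ j ∈ range R, (f ((Z j ω k).2) + ∑ n ∈ range N, (f ((Z j ω (k + n)).1) - f ((Z j ω (k + n)).2))) - mk|}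
      ⊆ B ∪ {ω | ε ≤ |(R : ℝ)⁻¹ * ∑ j ∈ range R, f ((Z j ω k).2) - mk|} := by
    intro ω hω
    by_cases hωB : ω ∈ B
    · exact Or.inl hωB
    · right
      have hzero : ∀ j ∈ range R, ∑ n ∈ range N, (f ((Z j ω (k + n)).1) - f ((Z j ω (k + n)).2)) = 0 := by
        intro j hj
        by_contra hne
        exact hωB (Set.mem_biUnion (show j ∈ (range R : Set ℕ) from by exact_mod_cast hj) hne)
      have hsum : ∑ j ∈ range R, (f ((Z j ω k).2) + ∑ n ∈ range N, (f ((Z j ω (k + n)).1) - f ((Z j ω (k + n)).2))) =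
          ∑ j ∈ range R, f ((Z j ω k).2) := sum_congr rfl fun j hj => by rw [hzero j hj, add_zero]
      simp only [Set.mem_setOf_eq] at hω ⊢
      rwa [hsum] at hω
  have h1 := crnLag_replicas_some_correction_le hw0 hmax Khat hK ν hf ha hc k N hZm hlaw R
  have h2 := crnLag_replicas_readout_hoeffding_abs hw0 Khat hK ν hf ha hc k hZm hlaw hind hε hR
  calc μ.real {ω | ε ≤ |(R : ℝ)⁻¹ * ∑ j ∈ range R, (f ((Z j ω k).2) + ∑ n ∈ range N, (f ((Z j ω (k + n)).1) - f ((Z j ω (k + n)).2))) - mk|}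
      ≤ μ.real (B ∪ {ω | ε ≤ |(R : ℝ)⁻¹ * ∑ j ∈ range R, f ((Z j ω k).2) - mk|}) := measureReal_mono hsub
    _ ≤ μ.real B + μ.real {ω | ε ≤ |(R : ℝ)⁻¹ * ∑ j ∈ range R, f ((Z j ω k).2) - mk|} := measureReal_union_le _ _
    _ ≤ 2 * Real.exp (-(2 * R * ε ^ 2) / (c - a) ^ 2) + R * ((1 - (w x₀)⁻¹) ^ k * ν.real (Set.diagonal Ω)ᶜ) := by linarith

/-- **BURN-IN BUYS THE EQUILIBRIUM HOEFFDING BAR — ABOUT `π f` ITSELF**: for `ε ≥ 0`, `R ≥ 1` and every window `N`,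
`P(|H̄_R − π f| ≥ ε + r^k(c − a)) ≤ 2·exp(−2Rε²/(c − a)²) + R·r^k·p₀`. [ours] -/
theorem crnLag_replicas_burnIn_hoeffding_abs_target [MeasurableEq Ω] [Fact (Measurable w)] (hw0 : ∀ y, 0 < w y) {x₀ : Ω}
    (hmax : ∀ y, w y ≤ w x₀) [IsProbabilityMeasure (q.withDensity fun y => ENNReal.ofReal (w y))]
    (Khat : Kernel (Ω × Ω) (Ω × Ω)) [IsMarkovKernel Khat]
    (hK : ∀ z : Ω × Ω, Khat z = (q.prod (volume : Measure unitInterval)).map (fun p : Ω × unitInterval =>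
      ((if (p.2 : ℝ) * w z.1 ≤ w p.1 then p.1 else z.1), (if (p.2 : ℝ) * w z.2 ≤ w p.1 then p.1 else z.2))))
    (ν : Measure (Ω × Ω)) [IsProbabilityMeasure ν] {f : Ω → ℝ} (hf : Measurable f) {a c : ℝ} (ha : ∀ x, a ≤ f x)
    (hc : ∀ x, f x ≤ c) (k N : ℕ) (hZm : ∀ j, Measurable (Z j))
    (hlaw : ∀ j, μ.map (Z j) = Kernel.trajMeasure (X := fun _ : ℕ => Ω × Ω) ν
      (fun n : ℕ => Khat.comap (fun h : (i : ↥(Finset.Iic n)) → Ω × Ω => h ⟨n, Finset.mem_Iic.2 le_rfl⟩)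
        (measurable_pi_apply _)))
    (hind : iIndepFun Z μ) {ε : ℝ} (hε : 0 ≤ ε) {R : ℕ} (hR : 1 ≤ R) :
    μ.real {ω | ε + (1 - (w x₀)⁻¹) ^ k * (c - a) ≤
        |(R : ℝ)⁻¹ * ∑ j ∈ range R, (f ((Z j ω k).2) + ∑ n ∈ range N, (f ((Z j ω (k + n)).1) - f ((Z j ω (k + n)).2))) -
          ∫ x, f x ∂(q.withDensity fun y => ENNReal.ofReal (w y))|} ≤
      2 * Real.exp (-(2 * R * ε ^ 2) / (c - a) ^ 2) + R * ((1 - (w x₀)⁻¹) ^ k * ν.real (Set.diagonal Ω)ᶜ) := by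
  have hw : Measurable w := Fact.out
  haveI : IsProbabilityMeasure (ν.map Prod.snd) := Measure.isProbabilityMeasure_map measurable_snd.aemeasurable
  set mk := ∫ y, f y ∂((fun m : Measure Ω => m.bind (indepMH q w))^[k] (ν.map Prod.snd)) with hmk
  set πf := ∫ x, f x ∂(q.withDensity fun y => ENNReal.ofReal (w y)) with hπf
  set X : ℕ → Ω' → ℝ := fun j ω => f ((Z j ω k).2) + ∑ n ∈ range N, (f ((Z j ω (k + n)).1) - f ((Z j ω (k + n)).2)) with hX
  have hbias : |mk - πf| ≤ (1 - (w x₀)⁻¹) ^ k * (c - a) := integral_iterate_bind_indepMH_abs_le hw hw0 hmax k (ν.map Prod.snd) hf ha hc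
  have h := crnLag_replicas_burnIn_hoeffding_abs hw0 hmax Khat hK ν hf ha hc k N hZm hlaw hind hε hR
  have hsub : {ω | ε + (1 - (w x₀)⁻¹) ^ k * (c - a) ≤ |(R : ℝ)⁻¹ * ∑ j ∈ range R, X j ω - πf|} ⊆
      {ω | ε ≤ |(R : ℝ)⁻¹ * ∑ j ∈ range R, X j ω - mk|} := by
    intro ω hω
    simp only [Set.mem_setOf_eq] at hω ⊢
    have htri : |(R : ℝ)⁻¹ * ∑ j ∈ range R, X j ω - πf| ≤ |(R : ℝ)⁻¹ * ∑ j ∈ range R, X j ω - mk| + |mk - πf| :=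
      abs_sub_le ((R : ℝ)⁻¹ * ∑ j ∈ range R, X j ω) mk πf
    linarith
  show μ.real {ω | ε + (1 - (w x₀)⁻¹) ^ k * (c - a) ≤ |(R : ℝ)⁻¹ * ∑ j ∈ range R, X j ω - πf|} ≤ _
  exact (measureReal_mono hsub).trans h

/-! ## §3 The exactly unbiased (untruncated) estimator -/

omit [IsProbabilityMeasure μ] in
/-- **PER REPLICA `P(∃ m ≥ k, X_m ≠ X′_m along Z_j) ≤ r^k·p₀`** (transfer of GEN-38's `crn_chain_notMerged_after_le` along the law of the
stream); off this event every correction `D_{k+n}(Z_j)` vanishes. [ours, bookkeeping] -/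
theorem crnLag_replica_notMerged_after_le [MeasurableEq Ω] [Fact (Measurable w)] (hw0 : ∀ y, 0 < w y) {x₀ : Ω}
    (hmax : ∀ y, w y ≤ w x₀) [IsProbabilityMeasure (q.withDensity fun y => ENNReal.ofReal (w y))]
    (Khat : Kernel (Ω × Ω) (Ω × Ω)) [IsMarkovKernel Khat]
    (hK : ∀ z : Ω × Ω, Khat z = (q.prod (volume : Measure unitInterval)).map (fun p : Ω × unitInterval =>
      ((if (p.2 : ℝ) * w z.1 ≤ w p.1 then p.1 else z.1), (if (p.2 : ℝ) * w z.2 ≤ w p.1 then p.1 else z.2))))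
    (ν : Measure (Ω × Ω)) [IsProbabilityMeasure ν] (k : ℕ) (hZm : ∀ j, Measurable (Z j)) {j : ℕ}
    (hlaw : μ.map (Z j) = Kernel.trajMeasure (X := fun _ : ℕ => Ω × Ω) ν
      (fun n : ℕ => Khat.comap (fun h : (i : ↥(Finset.Iic n)) → Ω × Ω => h ⟨n, Finset.mem_Iic.2 le_rfl⟩)
        (measurable_pi_apply _))) :
    μ.real {ω | ∃ m, k ≤ m ∧ Z j ω m ∉ Set.diagonal Ω} ≤ (1 - (w x₀)⁻¹) ^ k * ν.real (Set.diagonal Ω)ᶜ := by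
  have hw : Measurable w := Fact.out
  have hE : MeasurableSet {z : ℕ → Ω × Ω | ∃ m, k ≤ m ∧ z m ∉ Set.diagonal Ω} := measurableSet_notMerged_after k
  have heq : μ.real {ω | ∃ m, k ≤ m ∧ Z j ω m ∉ Set.diagonal Ω} =
      (μ.map (Z j)).real {z : ℕ → Ω × Ω | ∃ m, k ≤ m ∧ z m ∉ Set.diagonal Ω} := by
    rw [measureReal_def, measureReal_def, Measure.map_apply (hZm j) hE]; rfl
  rw [heq, hlaw]
  exact crn_chain_notMerged_after_le hw hw0 hmax Khat hK ν k

/-- **BURN-IN BUYS THE EQUILIBRIUM HOEFFDING BAR FOR THE EXACTLY UNBIASED ESTIMATOR**: for `ε ≥ 0`, `R ≥ 1`,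
`P(|R⁻¹Σ_{j<R} H_k(Z_j) − π f| ≥ ε + r^k(c − a)) ≤ 2·exp(−2Rε²/(c − a)²) + R·r^k·p₀`, `H_k = f(Y_k) + Σ_{n≥0} D_{k+n}`. [ours] -/
theorem crnLag_untruncated_replicas_burnIn_hoeffding_abs_target [MeasurableEq Ω] [Fact (Measurable w)] (hw0 : ∀ y, 0 < w y) {x₀ : Ω}
    (hmax : ∀ y, w y ≤ w x₀) [IsProbabilityMeasure (q.withDensity fun y => ENNReal.ofReal (w y))]
    (Khat : Kernel (Ω × Ω) (Ω × Ω)) [IsMarkovKernel Khat]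
    (hK : ∀ z : Ω × Ω, Khat z = (q.prod (volume : Measure unitInterval)).map (fun p : Ω × unitInterval =>
      ((if (p.2 : ℝ) * w z.1 ≤ w p.1 then p.1 else z.1), (if (p.2 : ℝ) * w z.2 ≤ w p.1 then p.1 else z.2))))
    (ν : Measure (Ω × Ω)) [IsProbabilityMeasure ν] {f : Ω → ℝ} (hf : Measurable f) {a c : ℝ} (ha : ∀ x, a ≤ f x)
    (hc : ∀ x, f x ≤ c) (k : ℕ) (hZm : ∀ j, Measurable (Z j))
    (hlaw : ∀ j, μ.map (Z j) = Kernel.trajMeasure (X := fun _ : ℕ => Ω × Ω) ν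
      (fun n : ℕ => Khat.comap (fun h : (i : ↥(Finset.Iic n)) → Ω × Ω => h ⟨n, Finset.mem_Iic.2 le_rfl⟩)
        (measurable_pi_apply _)))
    (hind : iIndepFun Z μ) {ε : ℝ} (hε : 0 ≤ ε) {R : ℕ} (hR : 1 ≤ R) :
    μ.real {ω | ε + (1 - (w x₀)⁻¹) ^ k * (c - a) ≤
        |(R : ℝ)⁻¹ * ∑ j ∈ range R, (f ((Z j ω k).2) + ∑' n, (f ((Z j ω (k + n)).1) - f ((Z j ω (k + n)).2))) -
          ∫ x, f x ∂(q.withDensity fun y => ENNReal.ofReal (w y))|} ≤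
      2 * Real.exp (-(2 * R * ε ^ 2) / (c - a) ^ 2) + R * ((1 - (w x₀)⁻¹) ^ k * ν.real (Set.diagonal Ω)ᶜ) := by
  have hw : Measurable w := Fact.out
  haveI : IsProbabilityMeasure (ν.map Prod.snd) := Measure.isProbabilityMeasure_map measurable_snd.aemeasurable
  set mk := ∫ y, f y ∂((fun m : Measure Ω => m.bind (indepMH q w))^[k] (ν.map Prod.snd)) with hmk
  set πf := ∫ x, f x ∂(q.withDensity fun y => ENNReal.ofReal (w y)) with hπf
  set B : Set Ω' := ⋃ j ∈ range R, {ω | ∃ m, k ≤ m ∧ Z j ω m ∉ Set.diagonal Ω} with hB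
  have hbias : |mk - πf| ≤ (1 - (w x₀)⁻¹) ^ k * (c - a) := integral_iterate_bind_indepMH_abs_le hw hw0 hmax k (ν.map Prod.snd) hf ha hc
  -- off `B` every correction of every replica vanishes, so the untruncated average is the read-out average
  have hsub : {ω | ε + (1 - (w x₀)⁻¹) ^ k * (c - a) ≤
        |(R : ℝ)⁻¹ * ∑ j ∈ range R, (f ((Z j ω k).2) + ∑' n, (f ((Z j ω (k + n)).1) - f ((Z j ω (k + n)).2))) - πf|}
      ⊆ B ∪ {ω | ε ≤ |(R : ℝ)⁻¹ * ∑ j ∈ range R, f ((Z j ω k).2) - mk|} := by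
    intro ω hω
    by_cases hωB : ω ∈ B
    · exact Or.inl hωB
    · right
      have hzero : ∀ j ∈ range R, ∑' n, (f ((Z j ω (k + n)).1) - f ((Z j ω (k + n)).2)) = 0 := by
        intro j hj
        have hall : ∀ n, Z j ω (k + n) ∈ Set.diagonal Ω := fun n => by
          by_contra hne
          exact hωB (Set.mem_biUnion (show j ∈ (range R : Set ℕ) from by exact_mod_cast hj) ⟨k + n, Nat.le_add_right k n, hne⟩)
        have hD : (fun n => f ((Z j ω (k + n)).1) - f ((Z j ω (k + n)).2)) = fun _ => 0 := funext fun n => by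
          rw [Set.mem_diagonal_iff.1 (hall n), sub_self]
        rw [hD, tsum_zero]
      have hsum : ∑ j ∈ range R, (f ((Z j ω k).2) + ∑' n, (f ((Z j ω (k + n)).1) - f ((Z j ω (k + n)).2))) =
          ∑ j ∈ range R, f ((Z j ω k).2) := sum_congr rfl fun j hj => by rw [hzero j hj, add_zero]
      simp only [Set.mem_setOf_eq] at hω ⊢
      rw [hsum] at hω
      have htri : |(R : ℝ)⁻¹ * ∑ j ∈ range R, f ((Z j ω k).2) - πf| ≤ |(R : ℝ)⁻¹ * ∑ j ∈ range R, f ((Z j ω k).2) - mk| + |mk - πf| :=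
        abs_sub_le ((R : ℝ)⁻¹ * ∑ j ∈ range R, f ((Z j ω k).2)) mk πf
      linarith
  have hBle : μ.real B ≤ R * ((1 - (w x₀)⁻¹) ^ k * ν.real (Set.diagonal Ω)ᶜ) :=
    calc μ.real B ≤ ∑ j ∈ range R, μ.real {ω | ∃ m, k ≤ m ∧ Z j ω m ∉ Set.diagonal Ω} := measureReal_biUnion_finset_le _ _
      _ ≤ ∑ j ∈ range R, (1 - (w x₀)⁻¹) ^ k * ν.real (Set.diagonal Ω)ᶜ :=
          sum_le_sum fun j _ => crnLag_replica_notMerged_after_le hw0 hmax Khat hK ν k hZm (hlaw j)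
      _ = R * ((1 - (w x₀)⁻¹) ^ k * ν.real (Set.diagonal Ω)ᶜ) := by rw [sum_const, card_range, nsmul_eq_mul]
  have h2 := crnLag_replicas_readout_hoeffding_abs hw0 Khat hK ν hf ha hc k hZm hlaw hind hε hR
  calc μ.real {ω | ε + (1 - (w x₀)⁻¹) ^ k * (c - a) ≤
          |(R : ℝ)⁻¹ * ∑ j ∈ range R, (f ((Z j ω k).2) + ∑' n, (f ((Z j ω (k + n)).1) - f ((Z j ω (k + n)).2))) - πf|}
      ≤ μ.real (B ∪ {ω | ε ≤ |(R : ℝ)⁻¹ * ∑ j ∈ range R, f ((Z j ω k).2) - mk|}) := measureReal_mono hsub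
    _ ≤ μ.real B + μ.real {ω | ε ≤ |(R : ℝ)⁻¹ * ∑ j ∈ range R, f ((Z j ω k).2) - mk|} := measureReal_union_le _ _
    _ ≤ 2 * Real.exp (-(2 * R * ε ^ 2) / (c - a) ^ 2) + R * ((1 - (w x₀)⁻¹) ^ k * ν.real (Set.diagonal Ω)ᶜ) := by linarith

/-- **THE SAMPLE-SIZE RECIPE FOR THE EXACTLY UNBIASED COUPLED ESTIMATOR.**  `w` a `Fact`-measurable normalised weight maximal at `x₀` (`W = w(x₀)`,
`A = 1/W`); `MeasurableEq Ω`; `K̂` a CRN pair kernel; `Z_0, Z_1, …` mutually independent pair streams from ONE initial coupling `ν̂` one update ahead,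
`p₀ = ν̂(Δᶜ)`; `a ≤ f ≤ c` measurable with `a < c`; accuracy `ε > 0`, risk `δ > 0`; `R ≥ 1` pairs with `(c − a)²·log(4/δ) ≤ 2Rε²`; burn-in `k` with
`log((c − a)/ε) ≤ k·A` and `p₀ = 0 ∨ log(2R·p₀/δ) ≤ k·A`.  Then `P(|R⁻¹Σ_{j<R} H_k(Z_j) − π f| ≥ 2ε) ≤ δ`. [ours] -/
theorem crnLag_untruncated_replicas_budget [MeasurableEq Ω] [Fact (Measurable w)] (hw0 : ∀ y, 0 < w y) {x₀ : Ω}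
    (hmax : ∀ y, w y ≤ w x₀) [IsProbabilityMeasure (q.withDensity fun y => ENNReal.ofReal (w y))]
    (Khat : Kernel (Ω × Ω) (Ω × Ω)) [IsMarkovKernel Khat]
    (hK : ∀ z : Ω × Ω, Khat z = (q.prod (volume : Measure unitInterval)).map (fun p : Ω × unitInterval =>
      ((if (p.2 : ℝ) * w z.1 ≤ w p.1 then p.1 else z.1), (if (p.2 : ℝ) * w z.2 ≤ w p.1 then p.1 else z.2))))
    (ν : Measure (Ω × Ω)) [IsProbabilityMeasure ν] {f : Ω → ℝ} (hf : Measurable f) {a c : ℝ} (ha : ∀ x, a ≤ f x)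
    (hc : ∀ x, f x ≤ c) (hac : a < c) (k : ℕ) (hZm : ∀ j, Measurable (Z j))
    (hlaw : ∀ j, μ.map (Z j) = Kernel.trajMeasure (X := fun _ : ℕ => Ω × Ω) ν
      (fun n : ℕ => Khat.comap (fun h : (i : ↥(Finset.Iic n)) → Ω × Ω => h ⟨n, Finset.mem_Iic.2 le_rfl⟩)
        (measurable_pi_apply _)))
    (hind : iIndepFun Z μ) {ε δ : ℝ} (hε : 0 < ε) (hδ : 0 < δ) {R : ℕ} (hR : 1 ≤ R)
    (hRε : (c - a) ^ 2 * Real.log (4 / δ) ≤ 2 * R * ε ^ 2)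
    (hkε : Real.log ((c - a) / ε) ≤ k * (w x₀)⁻¹)
    (hkδ : ν.real (Set.diagonal Ω)ᶜ = 0 ∨ Real.log (2 * R * ν.real (Set.diagonal Ω)ᶜ / δ) ≤ k * (w x₀)⁻¹) :
    μ.real {ω | 2 * ε ≤
        |(R : ℝ)⁻¹ * ∑ j ∈ range R, (f ((Z j ω k).2) + ∑' n, (f ((Z j ω (k + n)).1) - f ((Z j ω (k + n)).2))) -
          ∫ x, f x ∂(q.withDensity fun y => ENNReal.ofReal (w y))|} ≤ δ := by
  have hW : 1 ≤ w x₀ := one_le_of_mode (q := q) hmax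
  have hr0 : 0 ≤ 1 - (w x₀)⁻¹ := sub_nonneg.2 (inv_le_one_of_one_le₀ hW)
  have hca : 0 < c - a := sub_pos.2 hac
  have hRpos : (0 : ℝ) < R := Nat.cast_pos.2 (by omega)
  -- (i) the bias allowance: `r^k (c − a) ≤ ε`
  have hbias : (1 - (w x₀)⁻¹) ^ k * (c - a) ≤ ε := by
    have h := one_sub_inv_pow_le_of_log_le hW (div_pos hε hca) (k := k) (by rwa [one_div, inv_div])
    calc (1 - (w x₀)⁻¹) ^ k * (c - a) ≤ ε / (c - a) * (c - a) := mul_le_mul_of_nonneg_right h hca.le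
      _ = ε := div_mul_cancel₀ ε hca.ne'
  -- (ii) the Hoeffding term: `2·exp(−2Rε²/(c − a)²) ≤ δ/2`
  have hexp : 2 * Real.exp (-(2 * R * ε ^ 2) / (c - a) ^ 2) ≤ δ / 2 := two_mul_exp_le_of_log_le hac hδ hRε
  -- (iii) the coupling term: `R·r^k·p₀ ≤ δ/2`
  have hcoup : R * ((1 - (w x₀)⁻¹) ^ k * ν.real (Set.diagonal Ω)ᶜ) ≤ δ / 2 := by
    rcases hkδ with h0 | hlog
    · rw [h0, mul_zero, mul_zero]; linarith
    · rcases (measureReal_nonneg (μ := ν) (s := (Set.diagonal Ω)ᶜ)).lt_or_eq with hp | hp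
      · have hy : 0 < δ / (2 * R * ν.real (Set.diagonal Ω)ᶜ) := by positivity
        have h := one_sub_inv_pow_le_of_log_le hW hy (k := k) (by rwa [one_div, inv_div])
        calc R * ((1 - (w x₀)⁻¹) ^ k * ν.real (Set.diagonal Ω)ᶜ)
            = (1 - (w x₀)⁻¹) ^ k * (R * ν.real (Set.diagonal Ω)ᶜ) := by ring
          _ ≤ δ / (2 * R * ν.real (Set.diagonal Ω)ᶜ) * (R * ν.real (Set.diagonal Ω)ᶜ) :=
              mul_le_mul_of_nonneg_right h (mul_nonneg hRpos.le hp.le)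
          _ = δ / 2 := by field_simp
      · rw [← hp, mul_zero, mul_zero]; linarith
  -- the event `{2ε ≤ |err|}` is inside `{ε + r^k(c − a) ≤ |err|}`
  have hsub : {ω | 2 * ε ≤
        |(R : ℝ)⁻¹ * ∑ j ∈ range R, (f ((Z j ω k).2) + ∑' n, (f ((Z j ω (k + n)).1) - f ((Z j ω (k + n)).2))) -
          ∫ x, f x ∂(q.withDensity fun y => ENNReal.ofReal (w y))|} ⊆
      {ω | ε + (1 - (w x₀)⁻¹) ^ k * (c - a) ≤
        |(R : ℝ)⁻¹ * ∑ j ∈ range R, (f ((Z j ω k).2) + ∑' n, (f ((Z j ω (k + n)).1) - f ((Z j ω (k + n)).2))) -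
          ∫ x, f x ∂(q.withDensity fun y => ENNReal.ofReal (w y))|} := fun ω hω => by
    simp only [Set.mem_setOf_eq] at hω ⊢; linarith
  have h := crnLag_untruncated_replicas_burnIn_hoeffding_abs_target hw0 hmax Khat hK ν hf ha hc k hZm hlaw hind hε.le hR
  calc μ.real {ω | 2 * ε ≤
          |(R : ℝ)⁻¹ * ∑ j ∈ range R, (f ((Z j ω k).2) + ∑' n, (f ((Z j ω (k + n)).1) - f ((Z j ω (k + n)).2))) -
            ∫ x, f x ∂(q.withDensity fun y => ENNReal.ofReal (w y))|}
      ≤ μ.real {ω | ε + (1 - (w x₀)⁻¹) ^ k * (c - a) ≤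
          |(R : ℝ)⁻¹ * ∑ j ∈ range R, (f ((Z j ω k).2) + ∑' n, (f ((Z j ω (k + n)).1) - f ((Z j ω (k + n)).2))) -
            ∫ x, f x ∂(q.withDensity fun y => ENNReal.ofReal (w y))|} := measureReal_mono hsub
    _ ≤ 2 * Real.exp (-(2 * R * ε ^ 2) / (c - a) ^ 2) + R * ((1 - (w x₀)⁻¹) ^ k * ν.real (Set.diagonal Ω)ᶜ) := h
    _ ≤ δ := by linarith

end Replicas

end Summit.Ventures.LatticeQCDFlow.Exactness

end
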